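import Summits.BirchSwinnertonDyer.BirchSwinnertonDyer.Theorems.InertBadSignedBranchesKFormConsumers
import Summits.BirchSwinnertonDyer.BirchSwinnertonDyer.Theorems.CMRungInputs
import HarnessLib

/-!
# Route `InertBadSignedBranches` (rung K8): the RUNG BRIDGE in Kobayashi's (K)-form —
# `X12.CMInertBad` ⟸ crux `h₁` ∧ residuals `h₂ h₃` ∧ (hKO, h74, hC1K) ∧ `PublishedFactsInert`

Cell `b2b-bsdres`, unit `b2b-bsdres-x1b` (gen 47); the «matching CMRungInputs bridge variant» of planner
D85 (pub/bsd-cm, HOME/bsd-cm-plan/g14/START-HERE.md), sequel of `…KFormConsumers.lean` (p425824).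
HONEST FRAMING (verbatim in every file of the cell): tool theorem only, CONDITIONAL on every displayed
hypothesis — the K8 crux `h₁`, the HELD residuals `h₂` (off-type) and `h₃` (p = 3), the (K)-form even main
conjecture at `η` for CM curves `hC1K` (Pollack–Rubin p. 448 remark, conjecture-grade), the named facts
`hKO h74` and the conjunction `h₆`; the leaf `X12.CMInertBad` is NOT proved outright; nothing booked; no
label moves.
* `cmInertBad_of_inputs_kform` — word for word bsd-cm-ram's `CMRungInputs.cmInertBad_of_inputs` (p406906
  pattern) with the item `h₅ = PrintReadingsInert` ((F)-form conjunct 1 + readings) REPLACED by the triple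
  `(hKO : KitajimaOtsuki2018.mainThm13_…, h74 : Kobayashi2003.thm74_…, hC1K : (K)-form even MC at η for CM)`:
  on the type `(p, I₀*)`, `p ≥ 5`, `BSDp` comes from `KFormReadings.bsdp_of_hasSignedLocalType_IstarZero_of_
  valuation_of_etaEvenMC` (no `hC1`, no `h74x`, no `hper`); off the type `h₂`; at `p = 3` `h₃`.
So a route edit restating 19226's conjunct 1 in (K)-form (planner D85 / k8i-ty MEMO-19226-FORMS §2) can
re-point its deciding theorem at this bridge: `closes h₁ h₂ h₃ h₅' h₆ := cmInertBad_of_inputs_kform h₁ h₂ h₃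
hKO h74 h₅' h₆` once `hKO h74` are supplied by name (both are Literature facts) — the planner's pen.
References: S. Kobayashi, Invent. Math. 152 (2003) §4, Thm. 7.4; T. Kitajima, R. Otsuki (2018) Main Thm. 1.3;
HOME `b2b-bsdres-x1b/X12-ROUTE.md` §51.
-/

set_option autoImplicit false
set_option linter.dupNamespace false

noncomputable section

open scoped Classical

open CongruenceSubgroup Field Function NumberField IsDedekindDomain WeierstrassCurve
open Literature.NumberTheory.EllipticCurves
open Literature.NumberTheory.EllipticCurves.ModularForms
open Literature.NumberTheory.EllipticCurves.Rank1Residual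
open Literature.NumberTheory.EllipticCurves.Rank1Residual.Typed
open Literature.NumberTheory.GaloisRepresentations
open Literature.NumberTheory.GaloisCohomology
open ZpExtension
open Summit.BirchSwinnertonDyer.Rank1Residual Summit.BirchSwinnertonDyer.Rank1Residual.Additive
open Summit.BirchSwinnertonDyer.Rank1Residual.X12.O10

namespace Summit.BirchSwinnertonDyer.BirchSwinnertonDyer.Theorems.KFormReadings

/-- **THE K8 RUNG BRIDGE IN (K)-FORM: `X12.CMInertBad` ⟸ `h₁` (crux C-cc-1 on the type) ∧ `h₂`
(off-type residual) ∧ `h₃` (p = 3 residual) ∧ `hKO` ∧ `h74` ∧ `hC1K` ∧ `h₆` (PublishedFactsInert).**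
Word for word `CMRungInputs.cmInertBad_of_inputs` with `h₅` replaced by `(hKO, h74, hC1K)`; on the type at
`p ≥ 5` the pair consumer `bsdp_of_hasSignedLocalType_IstarZero_of_valuation_of_etaEvenMC`. CONDITIONAL on
every displayed hypothesis; nothing booked. [cite: Kobayashi2003, §4 (p. 8), Thm. 7.4 (p. 13)]
[cite: KitajimaOtsuki2018, Main Thm. 1.3] [cite: Miller2011LMS, §1 and Def. 1.1] -/
theorem cmInertBad_of_inputs_kform
    (h₁ : ∀ (p : ℕ) [Fact p.Prime], 5 ≤ p → ∀ (W : WeierstrassCurve ℚ) [W.IsElliptic]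
      [W.IsGloballyMinimal], HasSignedLocalType W p (.Istar 0) → W.analyticRank = 1 →
      QuadraticBranchPAdicGrossZagierValuationAt W p)
    (h₂ : ∀ (W : WeierstrassCurve ℚ) [W.IsElliptic] [W.IsGloballyMinimal] (p : ℕ) [Fact p.Prime],
      W.HasCM → W.analyticRank = 1 → CMInert W p → ¬ Good W p → 5 ≤ p →
      ¬ HasSignedLocalType W p (.Istar 0) → X12.MissingInputAt W p)
    (h₃ : ∀ (W : WeierstrassCurve ℚ) [W.IsElliptic] [W.IsGloballyMinimal] [Fact (Nat.Prime 3)], W.HasCM →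
      W.analyticRank = 1 → CMInert W 3 → ¬ Good W 3 → X12.MissingInputAt W 3)
    (hKO : Literature.NumberTheory.EllipticCurves.KitajimaOtsuki2018.mainThm13_etaSignedSelmerDual_noFiniteSubmodule)
    (h74 : Literature.NumberTheory.EllipticCurves.Kobayashi2003.thm74_etaEvenMC_iff_etaOddMC)
    (hC1K : ∀ (p : ℕ) [Fact p.Prime], 5 ≤ p →
      ∀ (K₀ : Type) [Field K₀] [NumberField K₀] [IsCyclotomicExtension {p} ℚ K₀]
        [(galRange (K := ℚ) K₀).Normal] (η : absoluteGaloisGroup ℚ →* ℤˣ),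
        (∀ σ ∈ galRange (K := ℚ) K₀, η σ = 1) → η ≠ 1 →
      ∀ (V : WeierstrassCurve ℚ) [V.IsElliptic] [V.IsGloballyMinimal] {N : ℕ} [NeZero N]
        {f : CuspForm (Gamma0 N) 2}, V.HasCM →
        p ≠ 2 → V.HasGoodReductionAtPrime p → V.frobeniusTrace p = 0 → IsNewformOf V f →
      ∀ (ϖ : ℚ), (if Even (p / 2) then (ϖ : ℝ) * V.realPeriodRat = plusPeriod f
          else (ϖ : ℝ) * V.imaginaryPeriodRat = minusPeriod f) →
      ∀ (κ : ZpExtension ℚ p) (γ : absoluteGaloisGroup ℚ),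
        κ.IsCyclotomic → κ.IsTopGenerator γ → γ ∈ galRange (K := ℚ) K₀ → IsCyclotomicVariable p γ →
      ∀ (Lp : IwasawaAlgebra p), IsQuadraticBranchPlusLFunction f p ϖ Lp →
      ∀ D : EtaSignedSelmerDualData V κ K₀ ℚ_[p] η γ 1, D.charIdeal = Ideal.span {Lp})
    (h₆ : hasEntireLFunction_rat ∧ GrossZagier1986_thm_I_7_3 ∧ rank_eq_analyticRank_of_analyticRank_le_one ∧
      poitouTate_selmerStructure_duality_real ℚ ∧ exists_isNewformOf ∧ mazur_not_dvd_maninConstant_of_odd) :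
    Summit.BirchSwinnertonDyer.Rank1Residual.X12.CMInertBad := by
  intro W _ _ p _ hCM hr hp2 hin hbad
  have hp : p.Prime := Fact.out
  by_cases h3 : p = 3
  · subst h3
    exact h₃ W hCM hr hin hbad
  · have hp5 : 5 ≤ p := by
      by_contra hlt
      have hlt' : p < 5 := Nat.lt_of_not_le hlt
      interval_cases p
      · exact Nat.not_prime_zero hp
      · exact Nat.not_prime_one hp
      · exact hp2 rfl
      · exact h3 rfl
      · exact absurd hp (by decide)
    by_cases hT : HasSignedLocalType W p (.Istar 0)
    · obtain ⟨hmod, hGZ, hGZK, hPT, hnf, hM⟩ := h₆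
      have hB : BSDp W p :=
        bsdp_of_hasSignedLocalType_IstarZero_of_valuation_of_etaEvenMC W p hmod hGZ hGZK hPT hnf hM hKO h74
          hC1K (h₁ p hp5 W hT hr) hT hr hp5
      haveI : Finite W.sha := (hGZK W (by rw [hr])).2
      exact fun _ => missingPPartAt_of_bsdp W p hB
    · exact h₂ W p hCM hr hin hbad hp5 hT

end Summit.BirchSwinnertonDyer.BirchSwinnertonDyer.Theorems.KFormReadings

end
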